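import Mathlib
import HarnessLib
import Literature.Probability.LatticeModels.LatticeBootstrapFeasible
import Literature.Probability.LatticeModels.BoundaryLawFunctionalLevels
import Summits.CriticalPhenomena.Ising3DConformalLimit.Theorems.LatticeSDPCertificatesCertifiedWindowWalshInversion
import Summits.CriticalPhenomena.Ising3DConformalLimit.Theorems.LatticeSDPCertificatesCertifiedWindowBalanceGibbs
import Summits.CriticalPhenomena.Ising3DConformalLimit.Theorems.LatticeSDPCertificatesCertifiedWindowRowsBalance

/-!
# Route `LatticeSDPCertificates`, crux `CertifiedWindow` (stmt-CriticalPhenomena-5504):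
# LP-feasible functionals ARE boundary-law functionals (the LP reshape is lossless)

Helper file (`--supports stmt-CriticalPhenomena-5504`). The rev-4/5 skeleton of the crux
(`Cruxes/CertifiedWindow/Lines/birth.lean`, line `registered`) replaced the boundary stub
"every row-feasible level-`L` BOUNDARY-LAW functional is one-scale-factor ratio stable"
(`ν`-form) by its LP form "every ABSTRACT functional `E` that is normalised, moment-positive,
satisfies the one-site heat-bath rows inside `Λ_L` and the lattice-bootstrap rows is ratio stable"
(`stub_boundaryScaleStabilityLP`), and proved LP-form ⇒ `ν`-form. This file proves the converse
at the cost of one unit of level, so that the two forms are EQUIVALENT up to `k ↦ k + 1`: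

* `exists_boundaryLaw_of_rows` — an abstract `E : Finset (Site d) → ℝ` with `E ∅ = 1`,
  `0 ≤ Σ_{A⊆D} σ_A E(A)` and the heat-bath rows at every `x ∈ Λ_L` is, on subsets of `Λ_L`, the
  level-`(L-1)` boundary-law functional of a probability measure: Walsh inversion turns `E|_{Λ_L}`
  into a probability density `ρ` on `{±1}^{Λ_L}` (`walsh_inversion`, `walsh_density_nonneg`),
  the rows are single-site detailed balance of `ρ` at the sites of `Λ_{L-1}`
  (`balance_of_heatBathRows`), and detailed balance at every site of `Λ_{L-1}` makes `ρ` invariant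
  under the Gibbs kernel of `Λ_{L-1}` (`sum_mul_isingExpect_fixed_eq_of_balance`; this is the
  finite-volume form of "single-site DLR ⇒ DLR", Georgii 2011 Thm. 1.33, and of Cho–Sun 2023's
  remark that Gibbs-inside LP points are mixtures over boundary conditions);
* `stub_boundaryScaleStabilityLP_of_nuForm` — the `ν`-form of boundary scale stability (the
  rev-3 registered stub, = the conclusion type of `boundaryScaleStability_of_LP` in the skeleton)
  implies the LP form `stub_boundaryScaleStabilityLP` (registered, rev 4/5) with `k + 1`.

References: Friedli–Velenik 2017, Lemma 6.7 [FriedliVelenik2017]; Georgii 2011, Thm. 1.33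
[Georgii2011]; Cho–Sun 2023, Def. 11–12 [ChoSun2023]; the finite algebra is elementary [folklore].
-/

noncomputable section

namespace Summit.CriticalPhenomena.Ising3DConformalLimit.Theorems

open Literature.Probability.LatticeModels MeasureTheory Finset
open scoped symmDiff

/-! ### Finite mixtures of Dirac masses at glued configurations -/

/-- The integral of a bounded measurable function against a finite mixture of Dirac masses.
[folklore] -/
theorem integral_sum_smul_dirac {d : ℕ} (Λ : Finset (Site d)) (ρ : (↥Λ → ℤˣ) → ℝ)
    (hρ : ∀ τ, 0 ≤ ρ τ) {f : SpinConfig (Site d) → ℝ} (hf : Measurable f) (C : ℝ)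
    (hC : ∀ η, |f η| ≤ C) :
    ∫ η, f η ∂(Measure.sum fun τ : ↥Λ → ℤˣ =>
        (ENNReal.ofReal (ρ τ)) • Measure.dirac (glue Λ τ .plus)) =
      ∑ τ : ↥Λ → ℤˣ, ρ τ * f (glue Λ τ .plus) := by
  rw [Measure.sum_fintype, integral_finsetSum_measure]
  · refine Finset.sum_congr rfl fun τ _ => ?_
    rw [integral_smul_measure, integral_dirac' _ _ hf.stronglyMeasurable,
      ENNReal.toReal_ofReal (hρ τ), smul_eq_mul]
  · intro τ _
    refine Integrable.smul_measure ?_ ENNReal.ofReal_ne_top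
    exact Integrable.of_bound hf.aestronglyMeasurable C
      (Filter.Eventually.of_forall fun η => by rw [Real.norm_eq_abs]; exact hC η)

/-- A finite mixture of Dirac masses with nonnegative weights summing to `1` is a probability
measure. [folklore] -/
theorem isProbabilityMeasure_sum_smul_dirac {d : ℕ} (Λ : Finset (Site d))
    (ρ : (↥Λ → ℤˣ) → ℝ) (hρ : ∀ τ, 0 ≤ ρ τ) (h1 : ∑ τ : ↥Λ → ℤˣ, ρ τ = 1) :
    IsProbabilityMeasure (Measure.sum fun τ : ↥Λ → ℤˣ =>
        (ENNReal.ofReal (ρ τ)) • Measure.dirac (glue Λ τ .plus)) := by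
  constructor
  rw [Measure.sum_fintype, Measure.finsetSum_apply]
  simp only [Measure.smul_apply, measure_univ, smul_eq_mul, mul_one]
  rw [← ENNReal.ofReal_sum_of_nonneg fun τ _ => hρ τ, h1, ENNReal.ofReal_one]

/-! ### Neighbours of the inner box -/

/-- The neighbours of a site of `Λ_{L'}` lie in `Λ_{L'+1}`. [folklore] -/
theorem neighborFinset_subset_box_succ {d : ℕ} {L' : ℕ} {x : Site d} (hx : x ∈ box d L') :
    (zdGraph d).neighborFinset x ⊆ box d (L' + 1) := by
  intro y hy
  rw [SimpleGraph.mem_neighborFinset] at hy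
  have hxb := mem_box.1 hx
  rw [mem_box]
  intro j
  obtain ⟨i, h | h⟩ := (zdGraph_adj_iff x y).1 hy
  · subst h
    by_cases hji : j = i
    · subst hji; simp only [Pi.add_apply, Pi.single_eq_same]; have := hxb j; push_cast; omega
    · simp only [Pi.add_apply, Pi.single_eq_of_ne hji, add_zero]; have := hxb j; push_cast; omega
  · have hy' : y = x - Pi.single i 1 := by rw [h]; simp
    subst hy'
    by_cases hji : j = i
    · subst hji; simp only [Pi.sub_apply, Pi.single_eq_same]; have := hxb j; push_cast; omega
    · simp only [Pi.sub_apply, Pi.single_eq_of_ne hji, sub_zero]; have := hxb j; push_cast; omega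

/-! ### LP-feasible functionals are boundary-law functionals -/

/-- **An abstract functional with normalisation, moment positivity and the heat-bath rows inside
`Λ_L` is, on subsets of `Λ_L`, the level-`(L-1)` boundary-law functional of a probability
measure** (finite-volume "single-site DLR ⇒ DLR", Georgii 2011 Thm. 1.33; the Gibbs-inside LP
points of Cho–Sun 2023, Def. 11, are mixtures over boundary conditions). The measure is the
finite mixture of Dirac masses at the configurations `τ ∨ (+)` of `Λ_L` with the Walsh density of
`E` as weights. [cite: Georgii2011, Thm. 1.33] -/
theorem exists_boundaryLaw_of_rows {d : ℕ} (L : ℕ) (hL : 1 ≤ L) (β : ℝ)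
    (E : Finset (Site d) → ℝ) (h0 : E ∅ = 1)
    (hpos : ∀ (D : Finset (Site d)) (σ : SpinConfig (Site d)),
      0 ≤ ∑ A ∈ D.powerset, spinProduct A σ * E A)
    (hrow : ∀ x : Site d, x ∈ box d L → ∀ (π : SpinConfig (Site d)) (B : Finset (Site d)), x ∉ B →
      ∑ S ∈ ((zdGraph d).neighborFinset x).powerset, spinProduct S π * E (insert x (symmDiff B S)) =
        Real.tanh (β * ∑ y ∈ (zdGraph d).neighborFinset x, spinAt y π) *
          ∑ S ∈ ((zdGraph d).neighborFinset x).powerset, spinProduct S π * E (symmDiff B S)) :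
    ∃ ν : Measure (SpinConfig (Site d)), IsProbabilityMeasure ν ∧
      ∀ A : Finset (Site d), A ⊆ box d L → boundaryLawFunctional d (L - 1) β ν A = E A := by
  classical
  set Λ : Finset (Site d) := box d L with hΛ
  -- the Walsh density of `E` on the configurations of `Λ`
  set ρ : (↥Λ → ℤˣ) → ℝ := fun τ =>
    ((2 : ℝ) ^ Λ.card)⁻¹ * ∑ A ∈ Λ.powerset, spinProduct A (glue Λ τ .plus) * E A with hρ
  have hW : ∀ B : Finset (Site d), B ⊆ Λ →
      ∑ τ : ↥Λ → ℤˣ, ρ τ * spinProduct B (glue Λ τ .plus) = E B :=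
    fun B hB => walsh_inversion E hB
  have hρ0 : ∀ τ, 0 ≤ ρ τ := fun τ => walsh_density_nonneg E (fun σ => hpos Λ σ) τ
  have hρ1 : ∑ τ : ↥Λ → ℤˣ, ρ τ = 1 := by rw [← h0]; exact walsh_total_mass E
  -- the inner box and its neighbours
  have hsub : box d (L - 1) ⊆ Λ := box_mono d (Nat.sub_le L 1)
  have hN : ∀ x ∈ box d (L - 1), (zdGraph d).neighborFinset x ⊆ Λ := by
    intro x hx
    have h := neighborFinset_subset_box_succ hx
    rwa [Nat.sub_add_cancel hL] at h
  -- detailed balance at every site of the inner box, from the heat-bath rows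
  have hbal : ∀ i : ↥Λ, (i : Site d) ∈ box d (L - 1) → ∀ τ : ↥Λ → ℤˣ,
      ρ τ * Real.exp (-(β * spinAt (i : Site d) (glue Λ τ .plus) *
          ∑ y ∈ (zdGraph d).neighborFinset (i : Site d), spinAt y (glue Λ τ .plus))) =
        ρ (Function.update τ i (-τ i)) * Real.exp (β * spinAt (i : Site d) (glue Λ τ .plus) *
          ∑ y ∈ (zdGraph d).neighborFinset (i : Site d), spinAt y (glue Λ τ .plus)) := by
    intro i hi τ
    have h := balance_of_heatBathRows (zdGraph d) Λ β E ρ hW i.2 (hN _ hi)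
      (fun π B _ hxB => hrow i (hsub hi) π B hxB) τ
    simpa only [Subtype.coe_eta] using h
  -- the boundary law
  refine ⟨Measure.sum fun τ : ↥Λ → ℤˣ => (ENNReal.ofReal (ρ τ)) • Measure.dirac (glue Λ τ .plus),
    isProbabilityMeasure_sum_smul_dirac Λ ρ hρ0 hρ1, fun A hA => ?_⟩
  rw [boundaryLawFunctional_apply,
    integral_sum_smul_dirac Λ ρ hρ0 (measurable_isingCorr_fixed_box (L - 1) β A) 1
      fun η => abs_isingCorr_le_one (zdGraph d) (box d (L - 1)) β 0 _ A]
  -- invariance of `ρ` under the Gibbs kernel of the inner box, then Walsh inversion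
  have key := sum_mul_isingExpect_fixed_eq_of_balance (zdGraph d) hsub β ρ hbal
    (measurable_spinProduct A)
  simp only [isingCorr]
  rw [key]
  exact hW A hA

/-- **The `ν`-form of boundary scale stability implies its LP form (with `k + 1`)**: the converse
of `boundaryScaleStability_of_LP` of the crux skeleton. Given the LP hypotheses on an abstract `E`
at level `L ≥ (k+1) R`, `exists_boundaryLaw_of_rows` produces a probability boundary law `ν` whose
level-`(L-1)` functional agrees with `E` on subsets of `Λ_L`; it inherits the lattice-bootstrap
rows (`LatticeBootstrapFeasible.congr`, `.of_le`), and the `ν`-form applies at level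
`L - 1 ≥ k R`. [folklore] -/
theorem stub_boundaryScaleStabilityLP_of_nuForm
    (hν : ∀ cw Cw : ℝ, 0 < cw → 0 < Cw → ∀ δ : ℝ, 0 < δ → ∃ K : ℝ, 0 < K ∧ ∀ q : ℕ, 2 ≤ q →
      ∃ k : ℕ, 1 ≤ k ∧ ∀ (L R : ℕ) (ν : Measure (SpinConfig (Site 3))), k * R ≤ L →
        IsProbabilityMeasure ν →
        LatticeBootstrapFeasible L cw Cw (boundaryLawFunctional 3 L (criticalBeta 3) ν) →
        ∀ n : ℕ, 1 ≤ n → q * n ≤ R →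
          criticalTwoPoint 3 (Pi.single 0 ((q * n : ℕ) : ℤ)) *
              boundaryLawFunctional 3 L (criticalBeta 3) ν {0, Pi.single 0 (n : ℤ)} ≤
            K * (q : ℝ) ^ δ * criticalTwoPoint 3 (Pi.single 0 (n : ℤ)) *
              boundaryLawFunctional 3 L (criticalBeta 3) ν {0, Pi.single 0 ((q * n : ℕ) : ℤ)}) :
    ∀ cw Cw : ℝ, 0 < cw → 0 < Cw → ∀ δ : ℝ, 0 < δ → ∃ K : ℝ, 0 < K ∧ ∀ q : ℕ, 2 ≤ q →
      ∃ k : ℕ, 1 ≤ k ∧ ∀ (L R : ℕ) (E : Finset (Site 3) → ℝ), k * R ≤ L → E ∅ = 1 →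
        (∀ (D : Finset (Site 3)) (σ : SpinConfig (Site 3)),
          0 ≤ ∑ A ∈ D.powerset, spinProduct A σ * E A) →
        (∀ x : Site 3, x ∈ box 3 L → ∀ (τ : SpinConfig (Site 3)) (B : Finset (Site 3)), x ∉ B →
          ∑ S ∈ ((zdGraph 3).neighborFinset x).powerset,
              spinProduct S τ * E (insert x (symmDiff B S)) =
            Real.tanh (criticalBeta 3 * ∑ y ∈ (zdGraph 3).neighborFinset x, spinAt y τ) *
              ∑ S ∈ ((zdGraph 3).neighborFinset x).powerset, spinProduct S τ * E (symmDiff B S)) →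
        LatticeBootstrapFeasible L cw Cw E →
        ∀ n : ℕ, 1 ≤ n → q * n ≤ R →
          criticalTwoPoint 3 (Pi.single 0 ((q * n : ℕ) : ℤ)) * E {0, Pi.single 0 (n : ℤ)} ≤
            K * (q : ℝ) ^ δ * criticalTwoPoint 3 (Pi.single 0 (n : ℤ)) *
              E {0, Pi.single 0 ((q * n : ℕ) : ℤ)} := by
  intro cw Cw hcw hCw δ hδ
  obtain ⟨K, hK, hq⟩ := hν cw Cw hcw hCw δ hδ
  refine ⟨K, hK, fun q hq2 => ?_⟩
  obtain ⟨k, hk, h⟩ := hq q hq2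
  refine ⟨k + 1, by omega, fun L R E hkR h0 hpos hrow hfeas n hn hqn => ?_⟩
  -- `R ≥ 2`, so `L ≥ k R + R ≥ 1` and `k R ≤ L - 1`
  have hR : 2 ≤ R := le_trans (le_trans (by omega) (Nat.mul_le_mul hq2 hn)) hqn
  have hL1 : 1 ≤ L := by nlinarith
  have hkR' : k * R ≤ L - 1 := by
    have : k * R + R ≤ L := by nlinarith
    omega
  obtain ⟨ν, hνP, hνE⟩ := exists_boundaryLaw_of_rows L hL1 (criticalBeta 3) E h0 hpos hrow
  -- the induced functional inherits the rows at level `L`, hence at level `L - 1`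
  have hfeas' : LatticeBootstrapFeasible (L - 1) cw Cw
      (boundaryLawFunctional 3 (L - 1) (criticalBeta 3) ν) :=
    (hfeas.congr fun A hA => hνE A hA).of_le (Nat.sub_le L 1)
  have key := h (L - 1) R ν hkR' hνP hfeas' n hn hqn
  -- the two pair sets lie in `Λ_L`
  have hbox : ∀ j : ℕ, j ≤ R → ({0, Pi.single 0 (j : ℤ)} : Finset (Site 3)) ⊆ box 3 L := by
    intro j hj
    refine pair_subset_box_three ?_
    rw [mem_box]
    intro i
    by_cases hi : i = 0
    · subst hi; simp only [Pi.single_eq_same]; constructor <;> nlinarith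
    · simp only [Pi.single_eq_of_ne hi]; constructor <;> nlinarith
  rw [hνE _ (hbox n (le_trans (Nat.le_mul_of_pos_left n (by omega)) hqn)),
    hνE _ (hbox (q * n) hqn)] at key
  exact key

/-- **Registered sub-goal `lpForm_of_nuForm` of item stmt-CriticalPhenomena-5504**: the
`ν`-form of boundary scale stability (conclusion type of `boundaryScaleStability_of_LP` in the
crux skeleton, = lead c2's `stub_boundaryScaleStability`) implies the registered LP form
`stub_boundaryScaleStabilityLP` — together with `boundaryScaleStability_of_LP` the two forms are
equivalent up to `k ↦ k + 1` (one line, fully qualified; proof =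
`stub_boundaryScaleStabilityLP_of_nuForm`). [folklore] -/
theorem lpForm_of_nuForm : (∀ cw Cw : ℝ, 0 < cw → 0 < Cw → ∀ δ : ℝ, 0 < δ → ∃ K : ℝ, 0 < K ∧ ∀ q : ℕ, 2 ≤ q → ∃ k : ℕ, 1 ≤ k ∧ ∀ (L R : ℕ) (ν : MeasureTheory.Measure (Literature.Probability.LatticeModels.SpinConfig (Literature.Probability.LatticeModels.Site 3))), k * R ≤ L → MeasureTheory.IsProbabilityMeasure ν → Literature.Probability.LatticeModels.LatticeBootstrapFeasible L cw Cw (Literature.Probability.LatticeModels.boundaryLawFunctional 3 L (Literature.Probability.LatticeModels.criticalBeta 3) ν) → ∀ n : ℕ, 1 ≤ n → q * n ≤ R → Literature.Probability.LatticeModels.criticalTwoPoint 3 (Pi.single 0 ((q * n : ℕ) : ℤ)) * Literature.Probability.LatticeModels.boundaryLawFunctional 3 L (Literature.Probability.LatticeModels.criticalBeta 3) ν {0, Pi.single 0 (n : ℤ)} ≤ K * (q : ℝ) ^ δ * Literature.Probability.LatticeModels.criticalTwoPoint 3 (Pi.single 0 (n : ℤ)) * Literature.Probability.LatticeModels.boundaryLawFunctional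 3 L (Literature.Probability.LatticeModels.criticalBeta 3) ν {0, Pi.single 0 ((q * n : ℕ) : ℤ)}) → ∀ cw Cw : ℝ, 0 < cw → 0 < Cw → ∀ δ : ℝ, 0 < δ → ∃ K : ℝ, 0 < K ∧ ∀ q : ℕ, 2 ≤ q → ∃ k : ℕ, 1 ≤ k ∧ ∀ (L R : ℕ) (E : Finset (Literature.Probability.LatticeModels.Site 3) → ℝ), k * R ≤ L → E ∅ = 1 → (∀ (D : Finset (Literature.Probability.LatticeModels.Site 3)) (σ : Literature.Probability.LatticeModels.SpinConfig (Literature.Probability.LatticeModels.Site 3)), 0 ≤ ∑ A ∈ D.powerset, Literature.Probability.LatticeModels.spinProduct A σ * E A) → (∀ x : Literature.Probability.LatticeModels.Site 3, x ∈ Literature.Probability.LatticeModels.box 3 L → ∀ (τ : Literature.Probability.LatticeModels.SpinConfig (Literature.Probability.LatticeModels.Site 3)) (B : Finset (Literature.Probability.LatticeModels.Site 3)), x ∉ B → ∑ S ∈ ((Literature.Probability.LatticeModels.zdGraph 3).neighborFinset x).powerset, Literature.Probability.LatticeModels.spinProduct S τ * E (insert x (symmDiff B S)) = Real.tanh (Literature.Probability.LatticeModels.criticalBeta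 3 * ∑ y ∈ (Literature.Probability.LatticeModels.zdGraph 3).neighborFinset x, Literature.Probability.LatticeModels.spinAt y τ) * ∑ S ∈ ((Literature.Probability.LatticeModels.zdGraph 3).neighborFinset x).powerset, Literature.Probability.LatticeModels.spinProduct S τ * E (symmDiff B S)) → Literature.Probability.LatticeModels.LatticeBootstrapFeasible L cw Cw E → ∀ n : ℕ, 1 ≤ n → q * n ≤ R → Literature.Probability.LatticeModels.criticalTwoPoint 3 (Pi.single 0 ((q * n : ℕ) : ℤ)) * E {0, Pi.single 0 (n : ℤ)} ≤ K * (q : ℝ) ^ δ * Literature.Probability.LatticeModels.criticalTwoPoint 3 (Pi.single 0 (n : ℤ)) * E {0, Pi.single 0 ((q * n : ℕ) : ℤ)} :=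
  stub_boundaryScaleStabilityLP_of_nuForm

end Summit.CriticalPhenomena.Ising3DConformalLimit.Theorems

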